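import Summits.BirchSwinnertonDyer.BirchSwinnertonDyer.Theorems.UniversalToricDescentThinCombTorsionTransferCocycle
import Summits.BirchSwinnertonDyer.BirchSwinnertonDyer.Theorems.SignedBaseChangeAnticyclotomicEisensteinDivisibilityPrimaryTorsionCofree
import Mathlib.LinearAlgebra.Matrix.Charpoly.LinearMap
import HarnessLib

/-!
# Torsion transfer for line `thin_comb` (crux `AdditiveSplitIMCInclusionAtThree`, stmt-BirchSwinnertonDyer-20395), part II:
# CAYLEY–HAMILTON for a Galois element on `E[p^∞]` and the curve-level LOCAL KILLING at a finite place
# (helper for `stub_torsionTransfer`, `--supports stmt-BirchSwinnertonDyer-20395`; cell `pub/bsd-wall`, lead `cruxlead-20395` g5)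

Sequel of `…TorsionTransferCocycle.lean` (§1–§3: a killing relation `Σ φᵢ ∘ δⁱ = 0` on the coefficients makes the conjugate-sum
`Σᵢ H¹(φᵢ)(conj_{δ^i} a)` of a class Greenberg at `v` over `K̄^{H₂}` STRICT at `v` over `K̄^{H}`). Here `M = E[p^∞]`:

* the `ℤ_p`-scalars `DistribSMul.toAddMonoidHom (PrimaryTorsion W.geomPoints p) c` of the tree's `PrimaryTorsion` read on the
  carrier `W.geomPrimaryTorsion p` (no new definition): `primaryTorsionScalar_eq_nsmul` (`= (c mod p^k) •` on `p^k`-torsion),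
  `…_natCast/_add/_mul/_smul_comm`.
* `exists_monic_sum_primaryTorsionScalar_pow_smul_eq_zero` — **Cayley–Hamilton**: for every `δ ∈ Γ_K` there is a MONIC `P = Σ cᵢ Xⁱ ∈ ℤ_p[X]`
  with `Σ cᵢ · δⁱ m = 0` on `E[p^∞]` (the Pontryagin dual `Hom(E[p^∞], ℚ/ℤ)` is finitely generated over `ℤ_p`,
  `SignedBaseChangeAcDivPrimaryTorsionCofree.module_finite_characterModule`; Mathlib `LinearMap.exists_monic_and_aeval_eq_zero` for the
  dual of `δ`; characters separate points).
* `sum_primaryTorsionScalar_conjH1_mem_strictKer` — the curve-level killing: for normal `H₂ ≤ H ≤ Γ_K` with `[Γ_K, Γ_K] ⊆ H₂`, `δ ∈ D_v` and its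
  Cayley–Hamilton polynomial, every `a ∈ H¹(H, E[p^∞])` Greenberg at `v` after restriction to `H₂` has `Σᵢ H¹(cᵢ)(conj_{δ^i} a)` strict at
  `v` over `K̄^{H}`.

At the WALL (`H₂ = Gal(K̄/K̃_∞)`, `H = Gal(K̄/K_∞^{ac})`, `v = 𝔭′ ∣ 3`, `δ ≡ γ^{3^m}` a decomposition element not fixing `K_∞^{ac}` — Brink)
this is the `𝔭′`-local input of the cokernel of control WITHOUT Serre's vanishing. No named fact, no `sorry`; nothing about BSD or the
crux is asserted here.

References: [Serre1968] Ch. I §1.2 (`E_{ℓ^∞} = V_ℓ/T_ℓ`, the `ℤ_ℓ[G]`-module); [SkinnerUrban2014] Prop. 3.2.8 (p. 23); [GreenbergLNM1716]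
§3 Lemma 3.3; [Lang1990] Ch. 5 §1 (`ℤ_p`-action through `ℤ/p^k`).
-/

set_option linter.dupNamespace false
set_option autoImplicit false

noncomputable section

open scoped Classical

open NumberField IsDedekindDomain Field
open Literature.NumberTheory.EllipticCurves Literature.NumberTheory.EllipticCurves.GreenbergSelmer
  Literature.NumberTheory.GaloisRepresentations Literature.NumberTheory.EllipticCurves.Castella2018

universe u

namespace Summit.BirchSwinnertonDyer.BirchSwinnertonDyer.Theorems.UniversalToricDescentThinComb.TorsionTransferLocal

/-! ## §4 `M = E[p^∞]`: Cayley–Hamilton for a Galois element and the curve-level killing -/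

section Curve

variable {K : Type} [Field K] (W : WeierstrassCurve K) (p : ℕ) [Fact p.Prime]

/-! The `ℤ_p`-scalar `c` on `E[p^∞] = W.geomPrimaryTorsion p` is written `DistribSMul.toAddMonoidHom (PrimaryTorsion W.geomPoints p) c`
(the `ℤ_p`-module structure of the tree's `PrimaryTorsion` on the same carrier; `c • a = (c mod p^k) • a` for `p^k a = 0`). -/

variable {W p}

/-- The `ℤ_p`-scalar at an exponent: `c · m = (c mod p^k) • m` whenever `p^k • m = 0`. [cite: Lang1990, Ch. 5 §1] -/
theorem primaryTorsionScalar_eq_nsmul (c : ℤ_[p]) (m : W.geomPrimaryTorsion p) {k : ℕ} (hk : p ^ k • m = 0) :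
    (DistribSMul.toAddMonoidHom (PrimaryTorsion W.geomPoints p) c m : W.geomPrimaryTorsion p) =
      (PadicInt.toZModPow k c).val • m := by
  apply Subtype.ext
  have hk' : p ^ k • ((m : PrimaryTorsion W.geomPoints p) : W.geomPoints) = 0 := by
    have h := congrArg Subtype.val hk
    rw [AddSubgroupClass.coe_nsmul] at h
    exact h
  have h := PrimaryTorsion.val_smul_eq_zpT c (m : PrimaryTorsion W.geomPoints p) hk'
  rw [IwasawaDual.zpT_def] at h
  exact h

/-- Natural-number scalars are natural multiples. [cite: Lang1990, Ch. 5 §1] -/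
theorem primaryTorsionScalar_natCast (n : ℕ) (m : W.geomPrimaryTorsion p) :
    (DistribSMul.toAddMonoidHom (PrimaryTorsion W.geomPoints p) (n : ℤ_[p]) m : W.geomPrimaryTorsion p) = n • m :=
  PrimaryTorsion.natCast_smul (A := W.geomPoints) n m

/-- The `ℤ_p`-scalars are additive in the scalar. [cite: Lang1990, Ch. 5 §1] -/
theorem primaryTorsionScalar_add (c d : ℤ_[p]) (m : W.geomPrimaryTorsion p) :
    (DistribSMul.toAddMonoidHom (PrimaryTorsion W.geomPoints p) (c + d) m : W.geomPrimaryTorsion p) =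
      DistribSMul.toAddMonoidHom (PrimaryTorsion W.geomPoints p) c m +
        DistribSMul.toAddMonoidHom (PrimaryTorsion W.geomPoints p) d m := by
  letI : Module ℤ_[p] (W.geomPrimaryTorsion p) := PrimaryTorsion.instModule
  exact add_smul c d m

/-- The `ℤ_p`-scalars are multiplicative in the scalar. [cite: Lang1990, Ch. 5 §1] -/
theorem primaryTorsionScalar_mul (c d : ℤ_[p]) (m : W.geomPrimaryTorsion p) :
    (DistribSMul.toAddMonoidHom (PrimaryTorsion W.geomPoints p) (c * d) m : W.geomPrimaryTorsion p) =
      DistribSMul.toAddMonoidHom (PrimaryTorsion W.geomPoints p) c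
        (DistribSMul.toAddMonoidHom (PrimaryTorsion W.geomPoints p) d m) := by
  letI : Module ℤ_[p] (W.geomPrimaryTorsion p) := PrimaryTorsion.instModule
  exact mul_smul c d m

/-- The `ℤ_p`-scalars commute with the Galois action. [cite: Serre1968, Ch. I §1.2] -/
theorem primaryTorsionScalar_smul_comm (c : ℤ_[p]) (g : absoluteGaloisGroup K) (m : W.geomPrimaryTorsion p) :
    (DistribSMul.toAddMonoidHom (PrimaryTorsion W.geomPoints p) c (g • m) : W.geomPrimaryTorsion p) =
      g • (DistribSMul.toAddMonoidHom (PrimaryTorsion W.geomPoints p) c m : W.geomPrimaryTorsion p) := by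
  letI : Module ℤ_[p] (W.geomPrimaryTorsion p) := PrimaryTorsion.instModule
  haveI : SMulCommClass (absoluteGaloisGroup K) ℤ_[p] (W.geomPrimaryTorsion p) := PrimaryTorsion.instSMulCommClass
  exact (smul_comm g c m).symm

variable (W p) in
/-- **Cayley–Hamilton for a Galois element on `E[p^∞]`**: for every `δ ∈ Γ_K` there is a MONIC `P = Σ cᵢ Xⁱ ∈ ℤ_p[X]` with
`Σ cᵢ · δⁱ m = 0` for all `m ∈ E[p^∞]`. The Pontryagin dual `Hom(E[p^∞], ℚ/ℤ)` is a finitely generated `ℤ_p`-module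
(`module_finite_characterModule`), so the dual of `δ` satisfies a monic polynomial (Mathlib `LinearMap.exists_monic_and_aeval_eq_zero`),
and characters separate points (`CharacterModule.eq_zero_of_character_apply`). [cite: Serre1968, Ch. I §1.2 (`T_ℓ`, `V_ℓ/T_ℓ = E_{ℓ^∞}`)] -/
theorem exists_monic_sum_primaryTorsionScalar_pow_smul_eq_zero [W.IsElliptic] (δ : absoluteGaloisGroup K) :
    ∃ P : Polynomial ℤ_[p], P.Monic ∧ ∀ m : W.geomPrimaryTorsion p,
      (∑ i ∈ Finset.range (P.natDegree + 1),
          DistribSMul.toAddMonoidHom (PrimaryTorsion W.geomPoints p) (P.coeff i) (δ ^ i • m) : W.geomPrimaryTorsion p) = 0 := by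
  classical
  set A := PrimaryTorsion W.geomPoints p with hA
  let f : A →ₗ[ℤ_[p]] A := DistribSMul.toLinearMap ℤ_[p] A δ
  let fd : CharacterModule A →ₗ[ℤ_[p]] CharacterModule A := CharacterModule.dual f
  haveI := SignedBaseChangeAcDivPrimaryTorsionCofree.module_finite_characterModule W p
  obtain ⟨P, hP, hPf⟩ := LinearMap.exists_monic_and_aeval_eq_zero ℤ_[p] fd
  refine ⟨P, hP, fun m ↦ ?_⟩
  have hf_pow : ∀ (i : ℕ) (a : A), (f ^ i) a = δ ^ i • a := by
    intro i a
    induction i with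
    | zero => rw [pow_zero, pow_zero, one_smul, Module.End.one_apply]
    | succ i ih => rw [pow_succ', Module.End.mul_apply, ih, pow_succ', mul_smul]; rfl
  have hfd_pow : ∀ (i : ℕ) (c : CharacterModule A) (a : A), ((fd ^ i) c) a = c ((f ^ i) a) := by
    intro i
    induction i with
    | zero => intro c a; rw [pow_zero, pow_zero, Module.End.one_apply, Module.End.one_apply]
    | succ i ih =>
      intro c a
      rw [pow_succ', Module.End.mul_apply, pow_succ, Module.End.mul_apply]
      change ((fd ^ i) c) (f a) = _
      rw [ih]
  -- characters separate points
  have key : ∀ a : A, ∑ i ∈ Finset.range (P.natDegree + 1), P.coeff i • (δ ^ i • a) = 0 := by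
    intro a
    refine CharacterModule.eq_zero_of_character_apply fun c ↦ ?_
    have h0 : (Polynomial.aeval fd P) c = 0 := by rw [hPf]; rfl
    rw [Polynomial.aeval_eq_sum_range, LinearMap.sum_apply] at h0
    let ev : CharacterModule A →+ AddCircle (1 : ℚ) :=
      { toFun := fun χ ↦ χ a, map_zero' := rfl, map_add' := fun _ _ ↦ rfl }
    have h1 : ev (∑ i ∈ Finset.range (P.natDegree + 1), (P.coeff i • fd ^ i) c) = 0 := by
      rw [h0]; rfl
    rw [map_sum] at h1
    rw [map_sum]
    refine Eq.trans (Finset.sum_congr rfl fun i _ ↦ ?_) h1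
    change c (P.coeff i • δ ^ i • a) = (P.coeff i • (fd ^ i) c) a
    rw [CharacterModule.smul_apply, hfd_pow, hf_pow, smul_comm (δ ^ i) (P.coeff i) a]
  exact key m

/-- **The curve-level killing at `𝔭′`.** For normal `H₂ ≤ H ≤ Γ_K` with `Γ_K/H₂` abelian, a finite place `v`, `δ ∈ D_v` and its
Cayley–Hamilton polynomial `P = Σ cᵢ Xⁱ` on `E[p^∞]`: if `a ∈ H¹(H, E[p^∞])` restricts into Greenberg's kernel for the strict datum at
`v` over `K̄^{H₂}`, then `Σᵢ H¹(cᵢ)(conj_{δ^i} a)` satisfies the strict condition at `v` over `K̄^{H}`.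
[cite: SkinnerUrban2014, Prop. 3.2.8 (p. 23)] [cite: GreenbergLNM1716, §3 Lemma 3.3] -/
theorem sum_primaryTorsionScalar_conjH1_mem_strictKer [NumberField K] {H H₂ : Subgroup (absoluteGaloisGroup K)} [H.Normal] [H₂.Normal]
    (hle : H₂ ≤ H) (hab : ∀ a b : absoluteGaloisGroup K, a⁻¹ * b * a * b⁻¹ ∈ H₂)
    {v : HeightOneSpectrum (𝓞 K)} {δ : absoluteGaloisGroup K} (hδ : δ ∈ decomp v)
    {P : Polynomial ℤ_[p]}
    (hkill : ∀ m : W.geomPrimaryTorsion p, (∑ i ∈ Finset.range (P.natDegree + 1),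
      DistribSMul.toAddMonoidHom (PrimaryTorsion W.geomPoints p) (P.coeff i) (δ ^ i • m) : W.geomPrimaryTorsion p) = 0)
    {a : W.subgroupH1 p H}
    (ha : W.resOfLe p hle a ∈ (AcSelmer.strictDatum (W.geomPrimaryTorsion p) v).greenbergKer H₂) :
    (∑ i ∈ Finset.range (P.natDegree + 1),
        resH1Hom (M := W.geomPrimaryTorsion p) (N := W.geomPrimaryTorsion p) (ContinuousMonoidHom.id H)
          (DistribSMul.toAddMonoidHom (PrimaryTorsion W.geomPoints p) (P.coeff i))
          (fun x m ↦ primaryTorsionScalar_smul_comm (P.coeff i) (x : absoluteGaloisGroup K) m) (W.conjH1 p H (δ ^ i) a)) ∈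
      (AcSelmer.strictDatum (W.geomPrimaryTorsion p) v).strictKer H :=
  sum_conjH1_mem_strictKer (M := W.geomPrimaryTorsion p) hle (fun g hg i _ ↦ pow_inv_mul_conj_mem hab v hδ g hg i)
    (fun i ↦ DistribSMul.toAddMonoidHom (PrimaryTorsion W.geomPoints p) (P.coeff i))
    (fun i ↦ primaryTorsionScalar_smul_comm (P.coeff i)) hkill ha

end Curve

end Summit.BirchSwinnertonDyer.BirchSwinnertonDyer.Theorems.UniversalToricDescentThinComb.TorsionTransferLocal

end
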